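import Summits.NavierStokesRegularity.NavierStokesRegularity.Theorems.RellichScarSymmetricScarExistsPeriodicWorld

/-!
# Crux `SymmetricScarExists` (stmt-NavierStokesRegularity-11718), line `logtime-bernoulli-certificate`:
# the spatial DECAY WEIGHTS are load-bearing for the bet — the rotating uniform drift

Refuter's negative lemma (drefute gen 3; `--supports stmt-NavierStokesRegularity-11718`; theorems only,
no definitions, no named facts).  Companion of `OneGoodSliceKinematicMember.lean` /
`OneGoodSliceWithoutMomentum.lean` (momentum deleted, all eight WEIGHTED bounds kept).  Here the Leray
MOMENTUM EQUATION IS KEPT and the weights are deleted instead: the class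
`LB(C, K) = {(U, P) : IsBackwardLeraySolutionOn univ 1 U P ∧ eight weighted bounds}` is replaced by
"`IsBackwardLeraySolutionOn univ 1 U P` ∧ the seven bounds `‖U‖ ≤ C`, `‖DU‖, ‖D²U‖, ‖∇P‖, ‖∂ₛU‖,
‖D∂ₛU‖, ‖∂ₛU + ½U + ½DU·y‖ ≤ K` WITHOUT the weights `(1 + ‖y‖)ᵏ`" (the pressure bound `|P| ≤ K` has to go
with the weights: the witness has a pressure linear in `y`).  An explicit ETERNAL CLASSICAL SOLUTION of
the backward Leray system lives in that class and has `‖∂ₛU‖ ≡ 1`: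

  `U(s, y) = sin s · e₀ + cos s · e₁`,  `P(s, y) = −⟪∂ₛU(s) + ½U(s), y⟫`

(the Leray image of the ODE blow-up `u(t, x) = (−t)^{−1/2}(sin log(1/(−t)) e₀ + cos log(1/(−t)) e₁)`,
`p` linear in `x`: Type-I RATE in time, no spatial decay — the "parasitic"/Serrin family, cf. KNSS 2009
§1).  Hence

* `oneGoodSlice_false_without_spatialDecay`: the statement of `stub_oneGoodSlice` (4′) with the weights
  deleted is FALSE (no slice has `‖∂ₛU‖ ≤ δ < 1` anywhere);
* `finiteGaussianAction_false_without_spatialDecay`: likewise for `stub_finiteGaussianAction` (4): the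
  Gaussian action density is the positive constant `∫ g`, so the action over `[s₁, s₂]` is
  `(s₂ − s₁) ∫ g`, unbounded.

Reading for the line: the bet is not a consequence of the Leray dynamics plus scale-invariant
BOUNDEDNESS (Type-I rate) — any proof of 4′/4/3 must use the spatial decay `(1 + ‖y‖)⁻ᵏ` of the apex
class (equivalently `HasTypeIDecay` of the physical profile), which is exactly what excludes the ODE
blow-up.  Together with the kinematic lemma: the bet needs BOTH the momentum equation AND the decay.
No `sorry`.
-/

noncomputable section

open Set Metric Function Filter MeasureTheory Topology InnerProductSpace
open scoped ContDiff Laplacian RealInnerProductSpace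

namespace Summit.NavierStokesRegularity.NavierStokesRegularity.Theorems.SymmetricScarExists.Negative

set_option linter.dupNamespace false

open Literature.Analysis.FluidPDE Literature.Analysis.FluidPDE.PineauVicol2026
open Summit.NavierStokesRegularity.NavierStokesRegularity.Theorems.SymmetricScarExists.LogtimeBernoulli

/-! ### Two calculus facts -/

section Calculus

variable {E : Type*} [NormedAddCommGroup E] [InnerProductSpace ℝ E] [CompleteSpace E]

/-- The gradient of the linear functional `y ↦ −⟪c, y⟫` is the constant vector `−c`. [folklore] -/
theorem gradient_neg_inner_const_left (c x : E) : gradient (fun y => -⟪c, y⟫) x = -c := by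
  have hfun : (fun y : E => -⟪c, y⟫) = fun y => ⟪-c, y⟫ := funext fun y => (inner_neg_left c y).symm
  have h : HasFDerivAt (fun y : E => ⟪-c, y⟫) (innerSL ℝ (-c)) x := (innerSL ℝ (-c)).hasFDerivAt
  rw [hfun, gradient, h.fderiv]
  apply (InnerProductSpace.toDual ℝ E).injective
  rw [LinearIsometryEquiv.apply_symm_apply]
  ext y
  simp [InnerProductSpace.toDual_apply_apply]

end Calculus

/-! ### The rotating uniform drift -/

section Drift

/-- **The rotating uniform drift is an eternal classical solution of the backward Leray system with
`‖∂ₛU‖ ≡ 1` and all UNWEIGHTED bounds.**  `U(s, y) = sin s · e₀ + cos s · e₁`,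
`P(s, y) = −⟪∂ₛU(s) + ½ U(s), y⟫`: `U` is spatially constant, so `DU = 0`, `ΔU = 0`, `(U·∇)U = 0`,
`div U = 0`, and Leray's momentum equation `∂ₛU + ½U + ½(y·∇)U + (U·∇)U + ∇P = ΔU` reduces to
`∇P = −(∂ₛU + ½U)`.  It is `2π`-periodic and `‖∂ₛU(s, y)‖ = ‖cos s · e₀ − sin s · e₁‖ = 1`. [folklore] -/
theorem exists_rotating_drift :
    ∃ (U : ℝ → EuclideanSpace ℝ (Fin 3) → EuclideanSpace ℝ (Fin 3)) (P : ℝ → EuclideanSpace ℝ (Fin 3) → ℝ),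
      IsBackwardLeraySolutionOn (univ : Set ℝ) 1 U P ∧
      (∀ (s : ℝ) (y : EuclideanSpace ℝ (Fin 3)), ‖U s y‖ ≤ 2 ∧ ‖fderiv ℝ (U s) y‖ ≤ 3 ∧
        ‖iteratedFDeriv ℝ 2 (U s) y‖ ≤ 3 ∧ ‖gradient (P s) y‖ ≤ 3 ∧
        ‖timeDerivWithin (univ : Set ℝ) U s y‖ ≤ 3 ∧
        ‖fderiv ℝ (fun z => timeDerivWithin (univ : Set ℝ) U s z) y‖ ≤ 3 ∧
        ‖timeDerivWithin (univ : Set ℝ) U s y + (1 / 2 : ℝ) • U s y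
            + (1 / 2 : ℝ) • fderiv ℝ (U s) y y‖ ≤ 3) ∧
      (∀ s y, U (s + 2 * Real.pi) y = U s y) ∧
      (∀ (s : ℝ) (y : EuclideanSpace ℝ (Fin 3)), ‖timeDerivWithin (univ : Set ℝ) U s y‖ = 1) := by
  -- ## the data
  set b : OrthonormalBasis (Fin 3) ℝ (EuclideanSpace ℝ (Fin 3)) := EuclideanSpace.basisFun (Fin 3) ℝ
    with hb
  set c : ℝ → EuclideanSpace ℝ (Fin 3) := fun s => Real.sin s • b 0 + Real.cos s • b 1 with hc
  set c' : ℝ → EuclideanSpace ℝ (Fin 3) := fun s => Real.cos s • b 0 + (-Real.sin s) • b 1 with hc'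
  set U : ℝ → EuclideanSpace ℝ (Fin 3) → EuclideanSpace ℝ (Fin 3) := fun s _ => c s with hU
  set P : ℝ → EuclideanSpace ℝ (Fin 3) → ℝ := fun s y => -⟪c' s + (1 / 2 : ℝ) • c s, y⟫ with hP
  -- ## orthonormality and sizes
  have hbn : ∀ i, ‖b i‖ = 1 := fun i => b.orthonormal.1 i
  have hb01 : ⟪b 0, b 1⟫ = (0 : ℝ) := (b.inner_eq_ite 0 1).trans (if_neg (by decide))
  have hnorm1 : ∀ a d : ℝ, a ^ 2 + d ^ 2 = 1 → ‖a • b 0 + d • b 1‖ = 1 := by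
    intro a d had
    have hsq : ‖a • b 0 + d • b 1‖ ^ 2 = 1 := by
      rw [← had, norm_add_sq_real, real_inner_smul_left, real_inner_smul_right, hb01, norm_smul,
        norm_smul, hbn, hbn, Real.norm_eq_abs, Real.norm_eq_abs, mul_one, mul_one, sq_abs, sq_abs]
      ring
    have h0 : 0 ≤ ‖a • b 0 + d • b 1‖ := norm_nonneg _
    nlinarith
  have hle2 : ∀ a d : ℝ, |a| ≤ 1 → |d| ≤ 1 → ‖a • b 0 + d • b 1‖ ≤ 2 := by
    intro a d ha hd
    calc ‖a • b 0 + d • b 1‖ ≤ ‖a • b 0‖ + ‖d • b 1‖ := norm_add_le _ _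
      _ = |a| + |d| := by rw [norm_smul, norm_smul, hbn, hbn, Real.norm_eq_abs, Real.norm_eq_abs,
          mul_one, mul_one]
      _ ≤ 2 := by linarith
  have hc2 : ∀ s, ‖c s‖ ≤ 2 := fun s => hle2 _ _ (Real.abs_sin_le_one s) (Real.abs_cos_le_one s)
  have hc'1 : ∀ s, ‖c' s‖ = 1 := fun s =>
    hnorm1 _ _ (by rw [neg_sq]; exact Real.cos_sq_add_sin_sq s)
  -- ## derivatives
  have hdt : ∀ s y, timeDerivWithin (univ : Set ℝ) U s y = c' s := by
    intro s y
    simp only [timeDerivWithin_apply, derivWithin_univ, hU]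
    exact (((Real.hasDerivAt_sin s).smul_const (b 0)).add
      ((Real.hasDerivAt_cos s).smul_const (b 1))).deriv
  have hDU : ∀ s y, fderiv ℝ (U s) y = 0 := fun s y => by
    simp only [hU]; exact fderiv_const_apply _
  have hDdt : ∀ s y, fderiv ℝ (fun z => timeDerivWithin (univ : Set ℝ) U s z) y = 0 := fun s y => by
    have : (fun z => timeDerivWithin (univ : Set ℝ) U s z) = fun _ => c' s := funext (hdt s)
    rw [this]; exact fderiv_const_apply _
  have hD2U : ∀ s y, iteratedFDeriv ℝ 2 (U s) y = 0 := fun s y => by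
    simp only [hU]
    rw [iteratedFDeriv_const_of_ne (by norm_num) (c s)]
    rfl
  have hgradP : ∀ s y, gradient (P s) y = -(c' s + (1 / 2 : ℝ) • c s) := fun s y =>
    gradient_neg_inner_const_left _ _
  -- ## the backward Leray system
  have hsol : IsBackwardLeraySolutionOn (univ : Set ℝ) 1 U P := by
    refine IsBackwardLeraySolutionOn.of_leray ?_ ?_ (fun s _ y => ?_) (fun s _ x => ?_)
    · -- smoothness of `U`
      have e : uncurry U = fun p : ℝ × EuclideanSpace ℝ (Fin 3) =>
          Real.sin p.1 • b 0 + Real.cos p.1 • b 1 := by funext p; rfl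
      unfold IsSmoothSpaceTimeOn; rw [e]
      exact (((Real.contDiff_sin.comp contDiff_fst).smul contDiff_const).add
        ((Real.contDiff_cos.comp contDiff_fst).smul contDiff_const)).contDiffOn
    · -- smoothness of `P`
      have e : uncurry P = fun p : ℝ × EuclideanSpace ℝ (Fin 3) =>
          -⟪(Real.cos p.1 • b 0 + (-Real.sin p.1) • b 1)
              + (1 / 2 : ℝ) • (Real.sin p.1 • b 0 + Real.cos p.1 • b 1), p.2⟫ := by
        funext p; rfl
      unfold IsSmoothSpaceTimeOn; rw [e]
      refine (ContDiff.inner ℝ ?_ contDiff_snd).neg.contDiffOn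
      exact (((Real.contDiff_cos.comp contDiff_fst).smul contDiff_const).add
        ((Real.contDiff_sin.comp contDiff_fst).neg.smul contDiff_const)).add
        ((((Real.contDiff_sin.comp contDiff_fst).smul contDiff_const).add
          ((Real.contDiff_cos.comp contDiff_fst).smul contDiff_const)).const_smul _)
    · -- Leray's momentum equation: `c' + ½ c + 0 + 0 + (−(c' + ½ c)) = Δ const = 0`
      rw [hdt, hDU, hgradP, convect_apply, hDU]
      have hΔ : (Δ (U s)) y = 0 := by simp only [hU, laplacian_const, Pi.zero_apply]
      rw [hΔ]
      simp only [zero_apply, smul_zero, add_zero, hU]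
      abel
    · -- incompressibility
      show LinearMap.trace ℝ _ (fderiv ℝ (U s) x : EuclideanSpace ℝ (Fin 3) →ₗ[ℝ] EuclideanSpace ℝ (Fin 3)) = 0
      rw [hDU]; simp
  -- ## assembly
  refine ⟨U, P, hsol, fun s y => ⟨hc2 s, ?_, ?_, ?_, ?_, ?_, ?_⟩, fun s y => ?_, fun s y => ?_⟩
  · rw [hDU, norm_zero]; norm_num
  · rw [hD2U, norm_zero]; norm_num
  · rw [hgradP, norm_neg]
    calc ‖c' s + (1 / 2 : ℝ) • c s‖ ≤ ‖c' s‖ + ‖(1 / 2 : ℝ) • c s‖ := norm_add_le _ _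
      _ ≤ 1 + 1 := by
          rw [hc'1, norm_smul, Real.norm_eq_abs, abs_of_pos (by norm_num : (0 : ℝ) < 1 / 2)]
          linarith [hc2 s]
      _ ≤ 3 := by norm_num
  · rw [hdt, hc'1]; norm_num
  · rw [hDdt, norm_zero]; norm_num
  · rw [hdt, hDU]
    simp only [zero_apply, smul_zero, add_zero, hU]
    calc ‖c' s + (1 / 2 : ℝ) • c s‖ ≤ ‖c' s‖ + ‖(1 / 2 : ℝ) • c s‖ := norm_add_le _ _
      _ ≤ 1 + 1 := by
          rw [hc'1, norm_smul, Real.norm_eq_abs, abs_of_pos (by norm_num : (0 : ℝ) < 1 / 2)]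
          linarith [hc2 s]
      _ ≤ 3 := by norm_num
  · simp only [hU, hc, Real.sin_add_two_pi, Real.cos_add_two_pi]
  · rw [hdt, hc'1]

/-! ### The two bet statements without the spatial decay weights -/

/-- **`stub_oneGoodSlice` is FALSE without the spatial decay weights** (momentum equation kept): for
the class of eternal classical solutions of the backward Leray system with the seven UNWEIGHTED bounds
`‖U‖ ≤ C`, `‖DU‖, ‖D²U‖, ‖∇P‖, ‖∂ₛU‖, ‖D∂ₛU‖, ‖∂ₛU + ½U + ½DU·y‖ ≤ K`, the rotating uniform drift has
`‖∂ₛU‖ ≡ 1`, so no slice is good for `δ = 1/2` (any `R`).  Any proof of 4′ must use the decay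
`(1 + ‖y‖)⁻ᵏ` of the apex class. [folklore] -/
theorem oneGoodSlice_false_without_spatialDecay :
    ¬ (∀ (C K : ℝ) (U : ℝ → EuclideanSpace ℝ (Fin 3) → EuclideanSpace ℝ (Fin 3)) (P : ℝ → EuclideanSpace ℝ (Fin 3) → ℝ), (Literature.Analysis.FluidPDE.IsBackwardLeraySolutionOn (Set.univ : Set ℝ) 1 U P ∧ ∀ (s : ℝ) (y : EuclideanSpace ℝ (Fin 3)), ‖U s y‖ ≤ C ∧ ‖fderiv ℝ (U s) y‖ ≤ K ∧ ‖iteratedFDeriv ℝ 2 (U s) y‖ ≤ K ∧ ‖gradient (P s) y‖ ≤ K ∧ ‖Literature.Analysis.FluidPDE.timeDerivWithin (Set.univ : Set ℝ) U s y‖ ≤ K ∧ ‖fderiv ℝ (fun z => Literature.Analysis.FluidPDE.timeDerivWithin (Set.univ : Set ℝ) U s z) y‖ ≤ K ∧ ‖Literature.Analysis.FluidPDE.timeDerivWithin (Set.univ : Set ℝ) U s y + (1 / 2 : ℝ) • U s y + (1 / 2 : ℝ) • fderiv ℝ (U s) y y‖ ≤ K) → ∀ δ : ℝ, 0 < δ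 → ∀ R : ℝ, 0 < R → (∃ sbar : ℝ, ∀ y : EuclideanSpace ℝ (Fin 3), ‖y‖ < R → ‖Literature.Analysis.FluidPDE.timeDerivWithin (Set.univ : Set ℝ) U sbar y‖ ≤ δ)) := by
  intro h
  obtain ⟨U, P, hsol, hbd, -, hone⟩ := exists_rotating_drift
  obtain ⟨sbar, hsbar⟩ := h 2 3 U P ⟨hsol, hbd⟩ (1 / 2) (by norm_num) 1 one_pos
  have h0 := hsbar 0 (by rw [norm_zero]; exact one_pos)
  rw [hone] at h0
  norm_num at h0

/-- **`stub_finiteGaussianAction` is FALSE without the spatial decay weights**: for the rotating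
uniform drift the Gaussian action density is the constant `∫ g > 0`, so
`∫_{s₁}^{s₂}∫‖∂ₛU‖² g = (s₂ − s₁) ∫ g` is unbounded. [folklore] -/
theorem finiteGaussianAction_false_without_spatialDecay :
    ¬ (∀ (C K : ℝ) (U : ℝ → EuclideanSpace ℝ (Fin 3) → EuclideanSpace ℝ (Fin 3)) (P : ℝ → EuclideanSpace ℝ (Fin 3) → ℝ), (Literature.Analysis.FluidPDE.IsBackwardLeraySolutionOn (Set.univ : Set ℝ) 1 U P ∧ ∀ (s : ℝ) (y : EuclideanSpace ℝ (Fin 3)), ‖U s y‖ ≤ C ∧ ‖fderiv ℝ (U s) y‖ ≤ K ∧ ‖iteratedFDeriv ℝ 2 (U s) y‖ ≤ K ∧ ‖gradient (P s) y‖ ≤ K ∧ ‖Literature.Analysis.FluidPDE.timeDerivWithin (Set.univ : Set ℝ) U s y‖ ≤ K ∧ ‖fderiv ℝ (fun z => Literature.Analysis.FluidPDE.timeDerivWithin (Set.univ : Set ℝ) U s z) y‖ ≤ K ∧ ‖Literature.Analysis.FluidPDE.timeDerivWithin (Set.univ : Set ℝ) U s y + (1 / 2 : ℝ) • U s y + (1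 / 2 : ℝ) • fderiv ℝ (U s) y y‖ ≤ K) → (∃ A : ℝ, ∀ s₁ s₂ : ℝ, s₁ ≤ s₂ → (∫ σ in s₁..s₂, (∫ y : EuclideanSpace ℝ (Fin 3), ‖Literature.Analysis.FluidPDE.timeDerivWithin (Set.univ : Set ℝ) U σ y‖ ^ 2 * Literature.Analysis.FluidPDE.PineauVicol2026.gaussWeight y)) ≤ A)) := by
  intro h
  obtain ⟨U, P, hsol, hbd, -, hone⟩ := exists_rotating_drift
  obtain ⟨A, hA⟩ := h 2 3 U P ⟨hsol, hbd⟩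
  -- the action density is the constant `∫ g`
  set I : ℝ := ∫ y : EuclideanSpace ℝ (Fin 3), gaussWeight y with hI
  have hF : ∀ σ, (∫ y : EuclideanSpace ℝ (Fin 3),
      ‖timeDerivWithin (univ : Set ℝ) U σ y‖ ^ 2 * gaussWeight y) = I := fun σ => by
    have : (fun y : EuclideanSpace ℝ (Fin 3) => ‖timeDerivWithin (univ : Set ℝ) U σ y‖ ^ 2 * gaussWeight y)
        = fun y => gaussWeight y := funext fun y => by rw [hone, one_pow, one_mul]
    rw [this]
  -- `∫ g > 0`
  have hIpos : 0 < I := by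
    have h1 := integral_norm_sq_mul_gaussWeight_pos (V := fun _ => timeDerivWithin (univ : Set ℝ) U 0 0)
      (K := 1) continuous_const (fun _ => (hone 0 0).le)
      (y₀ := 0) (by rw [← norm_ne_zero_iff, hone]; exact one_ne_zero)
    simpa only [hone, one_pow, one_mul] using h1
  -- the action over `[0, A/I + 1]`... take `s₂ = |A| / I + 1`
  have hs₂ : (0 : ℝ) ≤ |A| / I + 1 := by positivity
  have h := hA 0 (|A| / I + 1) hs₂
  simp only [hF, intervalIntegral.integral_const, smul_eq_mul, sub_zero] at h
  have : (|A| / I + 1) * I = |A| + I := by field_simp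
  rw [this] at h
  linarith [le_abs_self A]

end Drift

end Summit.NavierStokesRegularity.NavierStokesRegularity.Theorems.SymmetricScarExists.Negative

end
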